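import Summits.AtomisticToContinuum.Crystallization.Theorems.PerronTransitivityUniformBindingRigidityCohesionA

/-!
# Cohesion of uniformly bound Lennard-Jones configurations, II: reduction to a surface cluster bound

Helper file (`--supports stmt-AtomisticToContinuum-15099`) of the stub `stub_cohesion` of the line
`registered` (skeleton `Cruxes/UniformBindingRigidity/Lines/birth.lean`) of the crux
`Summit.AtomisticToContinuum.Crystallization.Theses.PerronTransitivity.UniformBindingRigidity`
(item stmt-AtomisticToContinuum-15099), continuing part I (`…CohesionA.lean`: `2e* < 0`, site sums,
absolute separation `1/4`, touching empty balls):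

* §5 tails of site sums beyond radius `R ≥ δ` are `≥ −(1/6)·1024/(δ³R³)`
  (`summable_and_neg_le_tsum_far`), the truncation of a site sum to any finite part containing all
  points within `R` costs at most that tail (`sum_le_tsum_add_of_far`), in particular
  `Σ_{z ∈ F ∖ {q}} V_LJ(dist q z) ≤ U_X(q) + (1/6)·1024/(δ³(L/2)³)` for the cluster
  `F = X ∩ closedBall p L` and `dist q p ≤ L/2` (`sum_erase_le_tsum_add`).
* §6 `cohesion_of_surfaceClusterBound` — the stub's statement VERBATIM, conditional on the SURFACE
  CLUSTER BOUND `H` (an inline hypothesis, not a named fact): for some margin `ε > 0` and all large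
  scales `L` there is a hole radius `ρ₀` such that in every finite `1/4`-separated cluster
  `F ⊆ closedBall p L ∋ p` lying outside an open ball of radius `≥ ρ₀` touching `p`, some site within
  `L/2` of `p` is bound worse than `2e* + ε` inside `F`.

What is deliberately NOT here: `H` itself.  The route card's single-site plan (one-sided kissing
`≤ 9` plus half shells, `≈ −1.0 > 2e* ≈ −1.435`) needs separation `≳ 0.85` at the touching site,
while a local bootstrap certifies at most `≈ 0.74` even with sharp packing constants (part I: `1/4`),
and at separation `≤ 0.8` an over-packed single site IS bound below `2e*` (`≈ 12` hemisphere
neighbours at distance `1` plus half shells `≈ −1.56`); so `H` is genuinely multi-site — a sitewise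
form of positive surface tension of Lennard-Jones matter, open (Blanc–Lewin 2015, §2.3).
All `[folklore]`.
-/

noncomputable section

namespace Summit.AtomisticToContinuum.Crystallization.Theorems.PerronTransitivityUniformBindingRigidity

open scoped BigOperators Topology
open Filter Set Metric
open Literature.MathematicalPhysics.StatisticalMechanics
open Summit.AtomisticToContinuum.Crystallization.Theorems.ChargedEnergyGapNegative (E3 eStar eStar_le)
open Summit.AtomisticToContinuum.Crystallization.Theorems.ExcessDecayLiouville
  (summable_inv_pow_of_separated tsum_inv_pow_le_of_separated)
open Summit.AtomisticToContinuum.Crystallization.Theorems.HullBulkOptimal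
  (summable_lennardJones_site abs_lennardJones_le tsum_finite_eq_sum)

/-! ## §5 Tails and truncation of site sums -/

section Truncation

variable {X : Set E3} {δ : ℝ}

/-- **Far tails of a site sum are small.** For a `δ`-separated `X ∋ q`, a radius `R ≥ δ` and any set
`B` of points of `X` at distance `≥ R` from `q`, the family `z ↦ V_LJ(dist q z)` over `B` is summable
and its sum is `≥ −(1/6)·1024/(δ³ R³)` (`V_LJ ≥ −r⁻⁶/6` and the dyadic shell bound
`tsum_inv_pow_le_of_separated`). [folklore] -/
theorem summable_and_neg_le_tsum_far (hδ : 0 < δ) (hsep : ∀ a ∈ X, ∀ b ∈ X, a ≠ b → δ ≤ dist a b)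
    (q : E3) {R : ℝ} (hR : δ ≤ R) {B : Set E3} (hB : B ⊆ {a : E3 | a ∈ X ∧ R ≤ dist a q}) :
    Summable (fun z : B => lennardJones (dist q (z : E3))) ∧
      -(1 / 6 * (1024 / (δ ^ 3 * R ^ 3))) ≤ ∑' z : B, lennardJones (dist q (z : E3)) := by
  have hR0 : 0 < R := hδ.trans_le hR
  -- the sixth-power family on the big index set and on `B`
  have hg : Summable fun a : ↥({a : E3 | a ∈ X ∧ R ≤ dist a q} : Set E3) =>
      (dist (a : E3) q)⁻¹ ^ (3 + 3) :=
    summable_inv_pow_of_separated (X := X) q (k := 3) (by norm_num) hδ hR hsep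
  have hgle : ∑' a : ↥({a : E3 | a ∈ X ∧ R ≤ dist a q} : Set E3), (dist (a : E3) q)⁻¹ ^ (3 + 3) ≤
      1024 / (δ ^ 3 * R ^ 3) :=
    tsum_inv_pow_le_of_separated (X := X) q (k := 3) (by norm_num) hδ hR hsep
  have hgB : Summable fun z : B => (dist (z : E3) q)⁻¹ ^ (3 + 3) := by
    have := hg.comp_injective (Set.inclusion_injective hB)
    exact this
  have hdist : ∀ z : B, R ≤ dist q (z : E3) := fun z => by
    rw [dist_comm]; exact (hB z.2).2
  -- summability of the Lennard-Jones family on `B`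
  have hV : Summable (fun z : B => lennardJones (dist q (z : E3))) := by
    refine Summable.of_norm_bounded (hgB.mul_left (δ⁻¹ ^ 6 / 12 + 1 / 6)) fun z => ?_
    rw [Real.norm_eq_abs, dist_comm q]
    have h := abs_lennardJones_le hδ (hR.trans ((hdist z).trans_eq (dist_comm _ _)))
    simpa using h
  refine ⟨hV, ?_⟩
  -- `Σ' V ≥ −(1/6) Σ'_B d⁻⁶ ≥ −(1/6) Σ'_{all far points} d⁻⁶ ≥ −(1/6)·1024/(δ³R³)`
  have h1 : ∑' z : B, -(1 / 6 * (dist (z : E3) q)⁻¹ ^ (3 + 3)) ≤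
      ∑' z : B, lennardJones (dist q (z : E3)) := by
    refine Summable.tsum_le_tsum (fun z => ?_) (hgB.mul_left (1 / 6)).neg hV
    rw [dist_comm q]
    have := ExcessDecayLiouvilleFineGrains.neg_inv_pow_six_le_lennardJones (dist (z : E3) q)
    simpa using this
  have h2 : ∑' z : B, (dist (z : E3) q)⁻¹ ^ (3 + 3) ≤
      ∑' a : ↥({a : E3 | a ∈ X ∧ R ≤ dist a q} : Set E3), (dist (a : E3) q)⁻¹ ^ (3 + 3) :=
    Summable.tsum_le_tsum_of_inj (Set.inclusion hB) (Set.inclusion_injective hB)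
      (fun c _ => by positivity) (fun z => le_rfl) hgB hg
  rw [tsum_neg, tsum_mul_left] at h1
  nlinarith

/-- **Truncation of a site sum to a finite part.** For a `δ`-separated `X`, a centre `a`, a radius
`R ≥ δ` and a finite set `I` of points of `X ∖ {a}` containing every point of `X ∖ {a}` at distance
`< R` from `a`: `Σ_{b ∈ I} V_LJ(dist a b) ≤ Σ'_{b ∈ X, b ≠ a} V_LJ(dist a b) + (1/6)·1024/(δ³R³)`
(the dropped points are at distance `≥ R`, where the tail bound applies). [folklore] -/
theorem sum_le_tsum_add_of_far (hδ : 0 < δ) (hsep : ∀ a ∈ X, ∀ b ∈ X, a ≠ b → δ ≤ dist a b)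
    (a : E3) {R : ℝ} (hR : δ ≤ R) (I : Finset E3) (hI : ∀ b ∈ I, b ∈ X ∧ b ≠ a)
    (hfar : ∀ b ∈ X, b ≠ a → b ∉ I → R ≤ dist b a) :
    ∑ b ∈ I, lennardJones (dist a b) ≤
      ∑' b : {b : E3 // b ∈ X ∧ b ≠ a}, lennardJones (dist a b.1) +
        1 / 6 * (1024 / (δ ^ 3 * R ^ 3)) := by
  classical
  set A : Set E3 := {b : E3 | b ∈ X ∧ b ≠ a ∧ b ∈ I} with hA
  set B : Set E3 := {b : E3 | b ∈ X ∧ b ≠ a ∧ b ∉ I} with hB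
  have hT : ({b : E3 | b ∈ X ∧ b ≠ a} : Set E3) = A ∪ B := by
    ext b
    simp only [hA, hB, mem_setOf_eq, mem_union]
    tauto
  have hdisj : Disjoint A B := by
    rw [Set.disjoint_left]
    rintro b ⟨-, -, h1⟩ ⟨-, -, h2⟩
    exact h2 h1
  have hAfin : A.Finite := (I.finite_toSet).subset fun b hb => hb.2.2
  have hAF : hAfin.toFinset = I := by
    ext b
    rw [Set.Finite.mem_toFinset]
    simp only [hA, mem_setOf_eq]
    constructor
    · exact fun h => h.2.2
    · exact fun h => ⟨(hI b h).1, (hI b h).2, h⟩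
  -- summability on the two pieces
  set f : E3 → ℝ := fun b => lennardJones (dist a b) with hf
  have hsA : Summable (f ∘ (↑) : A → ℝ) := by
    haveI := hAfin.to_subtype
    exact Summable.of_finite
  have hBsub : B ⊆ {b : E3 | b ∈ X ∧ R ≤ dist b a} := by
    rintro b ⟨hb, hba, hbI⟩
    exact ⟨hb, hfar b hb hba hbI⟩
  obtain ⟨hsB', htail⟩ := summable_and_neg_le_tsum_far hδ hsep a hR hBsub
  have hsB : Summable (f ∘ (↑) : B → ℝ) := hsB'
  -- split the site sum
  have h0 : (∑' b : {b : E3 // b ∈ X ∧ b ≠ a}, lennardJones (dist a b.1)) =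
      ∑' b : ↥({b : E3 | b ∈ X ∧ b ≠ a} : Set E3), f b := rfl
  have hsplit : ∑' b : {b : E3 // b ∈ X ∧ b ≠ a}, lennardJones (dist a b.1) =
      ∑' b : A, f b + ∑' b : B, f b := by
    rw [h0, tsum_congr_set_coe f hT]
    exact Summable.tsum_union_disjoint hdisj hsA hsB
  have hfinsum : ∑' b : A, f b = ∑ b ∈ I, lennardJones (dist a b) := by
    rw [← hAF]
    exact tsum_finite_eq_sum hAfin f
  have htail' : -(1 / 6 * (1024 / (δ ^ 3 * R ^ 3))) ≤ ∑' b : B, f b := htail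
  rw [hsplit, hfinsum]
  linarith

/-- **Binding of the local cluster.** For a `δ`-separated `X`, a centre `p`, a radius `L ≥ 2δ`, a
point `q` with `dist q p ≤ L/2` and the finite set `F` of the points of `X` in `closedBall p L`:
`Σ_{z ∈ F ∖ {q}} V_LJ(dist q z) ≤ Σ'_{z ∈ X, z ≠ q} V_LJ(dist q z) + (1/6)·1024/(δ³ (L/2)³)` — the
points of `X` outside `F` are at distance `> L/2` from `q`. [folklore] -/
theorem sum_erase_le_tsum_add (hδ : 0 < δ) (hsep : ∀ a ∈ X, ∀ b ∈ X, a ≠ b → δ ≤ dist a b)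
    {p q : E3} {L : ℝ} (hL : 2 * δ ≤ L) (hqp : dist q p ≤ L / 2) (F : Finset E3)
    (hF : ∀ z, z ∈ F ↔ z ∈ X ∧ dist z p ≤ L) :
    ∑ z ∈ F.erase q, lennardJones (dist q z) ≤
      ∑' z : {z : E3 // z ∈ X ∧ z ≠ q}, lennardJones (dist q z.1) +
        1 / 6 * (1024 / (δ ^ 3 * (L / 2) ^ 3)) := by
  refine sum_le_tsum_add_of_far hδ hsep q (by linarith) (F.erase q) (fun b hb => ?_) ?_
  · obtain ⟨hbq, hbF⟩ := Finset.mem_erase.1 hb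
    exact ⟨((hF b).1 hbF).1, hbq⟩
  · intro b hb hbq hbI
    have hbF : b ∉ F := fun h => hbI (Finset.mem_erase.2 ⟨hbq, h⟩)
    rw [hF] at hbF
    have hfar : L < dist b p := by
      by_contra h
      exact hbF ⟨hb, not_lt.1 h⟩
    have := dist_triangle b q p
    linarith

end Truncation

/-! ## §6 Cohesion reduced to a surface cluster bound -/

/-- **Cohesion (`stub_cohesion`) from a SURFACE CLUSTER BOUND.** The hypothesis `H` is the finite,
local, multi-site estimate this reduction leaves open: there are a margin `ε > 0` and a scale `L₀`
such that for every `L ≥ L₀` there is a hole radius `ρ₀` with the following property — in every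
finite `1/4`-separated cluster `F ⊆ closedBall p L` containing `p`, lying outside an open ball of
radius `dist y p ≥ ρ₀` whose boundary passes through `p` (`dist y p ≤ dist y a` for all `a ∈ F`),
SOME site `q ∈ F` within `L/2` of `p` is bound worse than `2e* + ε` inside the cluster:
`2e* + ε < Σ_{z ∈ F ∖ {q}} V_LJ(dist q z)`.  (Physically: sites next to a large void are
under-coordinated — one-sided kissing `≤ 9` first neighbours against `12`, about `−1.0` against
`2e* ≈ −1.435`; the multi-site form is essential, a single over-packed site can be bound below `2e*`.)
Given `H`, a non-empty uniformly discrete uniformly `2e*`-bound `X` is relatively dense: otherwise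
`X` is `1/4`-separated (`quarter_le_dist`, as `2e* < 0`), has touching empty balls of every radius
(`exists_touching`), and truncating the site sums of the cluster `X ∩ closedBall p L` at the touching
point costs at most `(1/6)·1024·4³·8/L³ ≤ ε` per site within `L/2` of `p` (`sum_erase_le_tsum_add`),
contradicting `H`. [folklore] -/
theorem cohesion_of_surfaceClusterBound
    (H : ∃ ε : ℝ, 0 < ε ∧ ∃ L₀ : ℝ, ∀ L : ℝ, L₀ ≤ L → ∃ ρ₀ : ℝ,
      ∀ (F : Finset (EuclideanSpace ℝ (Fin 3))) (p y : EuclideanSpace ℝ (Fin 3)), p ∈ F →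
        (∀ a ∈ F, ∀ b ∈ F, a ≠ b → 1 / 4 ≤ dist a b) →
        (∀ a ∈ F, dist a p ≤ L) →
        ρ₀ ≤ dist y p → (∀ a ∈ F, dist y p ≤ dist y a) →
        ∃ q ∈ F, dist q p ≤ L / 2 ∧
          2 * (⨅ Q : PeriodicConfiguration 3, Q.energyPerParticle lennardJones) + ε <
            ∑ z ∈ F.erase q, lennardJones (dist q z)) :
    ∀ X : Set (EuclideanSpace ℝ (Fin 3)), X.Nonempty →
      (∃ δ : ℝ, 0 < δ ∧ ∀ p ∈ X, ∀ q ∈ X, p ≠ q → δ ≤ dist p q) →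
      (∀ p ∈ X, ∑' q : {q : EuclideanSpace ℝ (Fin 3) // q ∈ X ∧ q ≠ p},
          lennardJones (dist p q.1) ≤
        2 * ⨅ Q : PeriodicConfiguration 3, Q.energyPerParticle lennardJones) →
      ∃ R : ℝ, ∀ y : EuclideanSpace ℝ (Fin 3), ∃ p ∈ X, dist y p ≤ R := by
  intro X hne hX hU
  by_contra hR
  -- absolute separation `1/4`
  have hsep : ∀ a ∈ X, ∀ b ∈ X, a ≠ b → 1 / 4 ≤ dist a b :=
    quarter_le_dist hX fun p hp => (hU p hp).trans two_mul_iInf_lt_zero.le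
  have h4 : (0 : ℝ) < 1 / 4 := by norm_num
  obtain ⟨ε, hε, L₀, hH⟩ := H
  -- the scale: `L ≥ L₀`, `L ≥ 2`, and `(1/6)·1024·4³·8 / L³ ≤ ε`
  set L : ℝ := max (max L₀ 2) (87382 / ε) with hLdef
  have hL₀ : L₀ ≤ L := (le_max_left _ _).trans (le_max_left _ _)
  have hL2 : 2 ≤ L := (le_max_right _ _).trans (le_max_left _ _)
  have hLε : 87382 / ε ≤ L := le_max_right _ _
  have hL0 : 0 < L := by linarith
  obtain ⟨ρ₀, hρ₀⟩ := hH L hL₀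
  -- a touching empty ball of radius `≥ ρ₀`
  obtain ⟨y, p, hp, hyp, hmin⟩ := exists_touching h4 hsep hne hR ρ₀
  -- the cluster `F = X ∩ closedBall p L`
  have hfin := finite_sep_ball h4 hsep p L
  set F : Finset E3 := hfin.toFinset with hFdef
  have hF : ∀ z, z ∈ F ↔ z ∈ X ∧ dist z p ≤ L := fun z => by
    rw [hFdef, Set.Finite.mem_toFinset]; rfl
  have hpF : p ∈ F := (hF p).2 ⟨hp, by rw [dist_self]; exact hL0.le⟩
  obtain ⟨q, hqF, hqp, hlt⟩ := hρ₀ F p y hpF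
    (fun a ha b hb hab => hsep a ((hF a).1 ha).1 b ((hF b).1 hb).1 hab)
    (fun a ha => ((hF a).1 ha).2) hyp (fun a ha => hmin a ((hF a).1 ha).1)
  have hq : q ∈ X := ((hF q).1 hqF).1
  -- truncation at `q`
  have htr := sum_erase_le_tsum_add h4 hsep (by linarith) hqp F hF
  have hUq := hU q hq
  -- the tail is at most `ε`
  have htail : 1 / 6 * (1024 / ((1 / 4 : ℝ) ^ 3 * (L / 2) ^ 3)) ≤ ε := by
    have hL1 : 1 ≤ L := by linarith
    have hL3 : L ≤ L ^ 3 := by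
      calc L = L * 1 * 1 := by ring
        _ ≤ L * L * L := by gcongr
        _ = L ^ 3 := by ring
    have hεL : 87382 ≤ ε * L := by
      rw [div_le_iff₀ hε] at hLε; linarith
    have hεL3 : 87382 ≤ ε * L ^ 3 := hεL.trans (mul_le_mul_of_nonneg_left hL3 hε.le)
    rw [show 1 / 6 * (1024 / ((1 / 4 : ℝ) ^ 3 * (L / 2) ^ 3)) = (262144 / 3) / L ^ 3 by
      field_simp; ring]
    rw [div_le_iff₀ (by positivity)]
    linarith
  linarith

/-! ## Registered sub-goal of `stub_cohesion`: the reduction -/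

/-- **Sub-goal `stub_cohesion_of_surfaceClusterBound` of the stub `stub_cohesion`** (registered on
stmt-AtomisticToContinuum-15099): the surface cluster bound implies the stub `stub_cohesion` verbatim
(`cohesion_of_surfaceClusterBound` in arrow form). [folklore] -/
theorem stub_cohesion_of_surfaceClusterBound :
    (∃ ε : ℝ, 0 < ε ∧ ∃ L₀ : ℝ, ∀ L : ℝ, L₀ ≤ L → ∃ ρ₀ : ℝ,
      ∀ (F : Finset (EuclideanSpace ℝ (Fin 3))) (p y : EuclideanSpace ℝ (Fin 3)), p ∈ F →
        (∀ a ∈ F, ∀ b ∈ F, a ≠ b → 1 / 4 ≤ dist a b) →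
        (∀ a ∈ F, dist a p ≤ L) →
        ρ₀ ≤ dist y p → (∀ a ∈ F, dist y p ≤ dist y a) →
        ∃ q ∈ F, dist q p ≤ L / 2 ∧
          2 * (⨅ Q : PeriodicConfiguration 3, Q.energyPerParticle lennardJones) + ε <
            ∑ z ∈ F.erase q, lennardJones (dist q z)) →
    ∀ X : Set (EuclideanSpace ℝ (Fin 3)), X.Nonempty →
      (∃ δ : ℝ, 0 < δ ∧ ∀ p ∈ X, ∀ q ∈ X, p ≠ q → δ ≤ dist p q) →
      (∀ p ∈ X, ∑' q : {q : EuclideanSpace ℝ (Fin 3) // q ∈ X ∧ q ≠ p},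
          lennardJones (dist p q.1) ≤
        2 * ⨅ Q : PeriodicConfiguration 3, Q.energyPerParticle lennardJones) →
      ∃ R : ℝ, ∀ y : EuclideanSpace ℝ (Fin 3), ∃ p ∈ X, dist y p ≤ R :=
  fun H => cohesion_of_surfaceClusterBound H

end Summit.AtomisticToContinuum.Crystallization.Theorems.PerronTransitivityUniformBindingRigidity

end
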